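/-
Cell b2b-lgcu-borel (gen 21).  VALUE = THEOREM (a dimension bound), NOT summit progress; the crux
item `SubgroupIdentityDesigns` (stmt-MatrixMultiplication-14079) stays open.
-/
import Mathlib
import Summits.MatrixMultiplication.MatrixMultiplication.Theorems.SubgroupIdentityDesigns.Negative.LevelOneInvariantDim
import Summits.MatrixMultiplication.MatrixMultiplication.Theorems.SubgroupIdentityDesigns.Negative.TwistedModuleLaw

/-!
# The `σ`-equivariants of the level-one space: `dim (F_1)_σ ≤ b · ν_σ(K)` (admissible orbits)

Route `LevelGradedCohnUmans`, crux `SubgroupIdentityDesigns` (stmt-MatrixMultiplication-14079), cells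
`(m, k) = (m, 1)`; report `run/shared/lean/b2b/levelgraded-cu/ORACLE-g21.md` §G21-2.  VALUE = THEOREM
(the level-one evaluation of the right-hand side of the twisted module law `TwistedModuleLaw`), NOT
summit progress; the crux item is untouched and remains open.

For a subgroup `K ≤ GL_m(𝔽_p)` and a linear character `σ : K →* ℂˣ` let
`(F_1)_σ = {f ∈ F_1 | f (g k) = σ(k) f g}` (`TwistedModuleLaw.eqvRight`).  Call a vector `u ∈ 𝔽_p^m`
`σ`-ADMISSIBLE if its stabiliser `K_u` lies in `ker σ` (the set `adm K σ`; a union of `K`-orbits,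
`smul_mem_adm_iff`), and let `ν_σ(K)` be the number of admissible `K`-orbits (`AdmOrb`; for `σ ≠ 1`
the orbit `{0}` is never admissible, so these are orbits on `𝔽_p^m ∖ 0`).  `b = #ℙ^{m-1}(𝔽_p)`.

* `finrank_eqvRight_levelOne_le` — **`dim (F_1)_σ ≤ ν_σ(K) · b`** for `σ ≠ 1`.
  Proof: the twisted right average `A_σ f (g) = Σ_{k ∈ K} σ(k)⁻¹ f (g k)` (`avgT`) is `|K| · f` on
  `(F_1)_σ` and maps the vector transports `t_{u,a} = [g u = a]` spanning `F_1` (`VectorTransportSpan`)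
  to `A_σ t_{u,a}` with `A_σ t_{k u, a} = σ(k) · A_σ t_{u,a}` (`avgT_transport_smul`).  Hence
  `A_σ t_{u,a} = 0` as soon as some `k ∈ K_u` has `σ(k) ≠ 1` (`avgT_transport_eq_zero`) — the
  non-admissible orbits (among them `{0}` and, for `a = 0`, everything) DISAPPEAR — and on an admissible
  orbit `A_σ t_{u,a}` is a scalar multiple of `A_σ t_{out ω(u), a}`; with `t_{u, μ a} = t_{μ⁻¹ u, a}` the
  targets reduce to line representatives.  So `(F_1)_σ` lies in the span of the `ν_σ(K) · b` functions
  `A_σ t_{out ω, rep ℓ}` (`ω` admissible, `ℓ` a line).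
  (The exact value is `|K| · dim (F_1)_σ = b · Σ_{v ≠ 0 adm} |K_v| − Σ_{lines L adm} |K_L|`, confirmed
  numerically in 44 cases, `code/g21/twist_check.py`; only the displayed bound is proved and used.)
* Compare `LevelOneInvariantDim.finrank_invRight_levelOne_le` (`σ = 1`): `dim (F_1)^K ≤ 1 + b (ν(K) − 1)`
  counts ALL orbits.  For subgroups rich in fixed points a suitable `σ ≠ 1` sees far fewer: the diagonal
  torus of `GL_m(𝔽_p)` (`p ≥ 3`) with `σ = ∏ χ(t_i)`, `χ ≠ 1`, has `ν_σ = 1` (the single regular orbit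
  `(𝔽_p^×)^m`), against `ν = 2^m − 1 + …` (`CharacterLaw`).
* Counting helpers for the law file: `card_admOrb_le_one`, `card_admOrb_eq_zero`.

Sorry-free; standard axioms.
-/

set_option linter.dupNamespace false

noncomputable section

open scoped BigOperators Classical Matrix LinearAlgebra.Projectivization
open Module (finrank)

namespace Summit.MatrixMultiplication.MatrixMultiplication.Theorems.SubgroupIdentityDesigns.Negative
namespace LevelOneEquivariantDim

open Summit.MatrixMultiplication.MatrixMultiplication.Theorems.LieRankDesigns.Negative (GLm Mat)
open Summit.MatrixMultiplication.MatrixMultiplication.Theorems.LevelOneGL2Designs.Negative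
  (levelSubmodule)
open VectorTransportSpan (levelSubmodule_le_of_transport)
open TwistedModuleLaw (eqvRight mem_eqvRight eqvRight_le)
open LevelOneInvariantDim (transport transport_apply transport_smul transport_zero_right Ω orb
  exists_smul_eq_out)

variable {p m : ℕ}

/-- The `σ`-ADMISSIBLE vectors: those whose stabiliser in `K` lies in `ker σ`. -/
def adm (K : Subgroup (GLm p m)) (σ : K →* ℂˣ) : Set (Fin m → ZMod p) :=
  {u | ∀ k : K, k • u = u → σ k = 1}

/-- Membership in `adm`. -/
theorem mem_adm {K : Subgroup (GLm p m)} {σ : K →* ℂˣ} {u : Fin m → ZMod p} :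
    u ∈ adm K σ ↔ ∀ k : K, k • u = u → σ k = 1 := Iff.rfl

/-- Admissibility is a property of the `K`-orbit (stabilisers along an orbit are conjugate and `σ`
is a class function). -/
theorem smul_mem_adm (K : Subgroup (GLm p m)) (σ : K →* ℂˣ) (k₀ : K) {u : Fin m → ZMod p}
    (h : u ∈ adm K σ) : k₀ • u ∈ adm K σ := by
  intro k hk
  have hk' : (k₀⁻¹ * k * k₀) • u = u := by
    rw [mul_smul, mul_smul, hk, inv_smul_smul]
  have h1 := h _ hk'
  rwa [map_mul, map_mul, map_inv, mul_right_comm, inv_mul_cancel, one_mul] at h1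

/-- Admissibility is orbit-invariant (iff form). -/
theorem smul_mem_adm_iff (K : Subgroup (GLm p m)) (σ : K →* ℂˣ) (k₀ : K) (u : Fin m → ZMod p) :
    k₀ • u ∈ adm K σ ↔ u ∈ adm K σ := by
  refine ⟨fun h => ?_, smul_mem_adm K σ k₀⟩
  have h' := smul_mem_adm K σ k₀⁻¹ h
  rwa [inv_smul_smul] at h'

/-- The admissible orbits (tested on the chosen representative): `ν_σ(K) = #AdmOrb`. -/
abbrev AdmOrb (K : Subgroup (GLm p m)) (σ : K →* ℂˣ) := {ω : Ω K // ω.out ∈ adm K σ}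

/-- If any two admissible vectors are `K`-translates, there is at most one admissible orbit. -/
theorem card_admOrb_le_one (K : Subgroup (GLm p m)) (σ : K →* ℂˣ)
    (h : ∀ u v : Fin m → ZMod p, u ∈ adm K σ → v ∈ adm K σ → ∃ k : K, k • u = v) :
    Nat.card (AdmOrb K σ) ≤ 1 := by
  haveI : Subsingleton (AdmOrb K σ) := ⟨fun ω ω' => by
    obtain ⟨k, hk⟩ := h _ _ ω.2 ω'.2
    apply Subtype.ext
    rw [← Quotient.out_eq ω.1, ← Quotient.out_eq ω'.1]
    exact Quotient.sound (MulAction.orbitRel_apply.2 (MulAction.mem_orbit_iff.2 ⟨k⁻¹, by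
      rw [← hk, inv_smul_smul]⟩))⟩
  exact Finite.card_le_one_iff_subsingleton.2 inferInstance

/-- If no vector is admissible, there is no admissible orbit. -/
theorem card_admOrb_eq_zero (K : Subgroup (GLm p m)) (σ : K →* ℂˣ)
    (h : ∀ u : Fin m → ZMod p, u ∉ adm K σ) : Nat.card (AdmOrb K σ) = 0 := by
  haveI : IsEmpty (AdmOrb K σ) := ⟨fun ω => h _ ω.2⟩
  exact Nat.card_of_isEmpty

/-- A non-trivial character takes a value `≠ 1`. -/
theorem exists_ne_one {K : Subgroup (GLm p m)} {σ : K →* ℂˣ} (hσ : σ ≠ 1) : ∃ k : K, σ k ≠ 1 := by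
  by_contra h
  simp only [not_exists, not_not] at h
  exact hσ (MonoidHom.ext fun k => by rw [h k, MonoidHom.one_apply])

/-- For `σ ≠ 1` the zero vector is not admissible (its stabiliser is `K`). -/
theorem zero_not_mem_adm {K : Subgroup (GLm p m)} {σ : K →* ℂˣ} (hσ : σ ≠ 1) :
    (0 : Fin m → ZMod p) ∉ adm K σ := by
  obtain ⟨k, hk⟩ := exists_ne_one hσ
  exact fun h => hk (h k (smul_zero _))

variable [hp : Fact p.Prime]

/-- The TWISTED right average `A_σ f : g ↦ Σ_{k ∈ K} σ(k)⁻¹ f (g k)`, a linear map. -/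
def avgT (K : Subgroup (GLm p m)) (σ : K →* ℂˣ) : (GLm p m → ℂ) →ₗ[ℂ] (GLm p m → ℂ) where
  toFun f g := ∑ k : K, (σ k⁻¹ : ℂ) * f (g * k)
  map_add' f f' := by funext g; simp [Finset.sum_add_distrib, mul_add]
  map_smul' c f := by
    funext g
    simp only [Pi.smul_apply, smul_eq_mul, RingHom.id_apply, Finset.mul_sum]
    exact Finset.sum_congr rfl fun k _ => by ring

/-- Unfolding `avgT`. -/
theorem avgT_apply (K : Subgroup (GLm p m)) (σ : K →* ℂˣ) (f : GLm p m → ℂ) (g : GLm p m) :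
    avgT K σ f g = ∑ k : K, (σ k⁻¹ : ℂ) * f (g * k) := rfl

/-- On `σ`-equivariants the twisted average is multiplication by `|K|`. -/
theorem avgT_of_mem_eqvRight {K : Subgroup (GLm p m)} {σ : K →* ℂˣ}
    {J : Submodule ℂ (GLm p m → ℂ)} {f : GLm p m → ℂ} (hf : f ∈ eqvRight K σ J) :
    avgT K σ f = (Fintype.card K : ℂ) • f := by
  funext g
  rw [avgT_apply, Pi.smul_apply]
  have : ∀ k : K, (σ k⁻¹ : ℂ) * f (g * k) = f g := fun k => by
    rw [(mem_eqvRight.1 hf).2 k g, ← mul_assoc, ← Units.val_mul, ← map_mul, inv_mul_cancel,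
      map_one, Units.val_one, one_mul]
  rw [Finset.sum_congr rfl fun k _ => this k, Finset.sum_const, Finset.card_univ, nsmul_eq_mul,
    smul_eq_mul]

/-- A `σ`-equivariant function lies in any submodule containing its twisted average. -/
theorem mem_of_avgT_mem {K : Subgroup (GLm p m)} {σ : K →* ℂˣ} {J T : Submodule ℂ (GLm p m → ℂ)}
    {f : GLm p m → ℂ} (hf : f ∈ eqvRight K σ J) (hT : avgT K σ f ∈ T) : f ∈ T := by
  have hK : (Fintype.card K : ℂ) ≠ 0 := by exact_mod_cast Fintype.card_ne_zero
  have : f = (Fintype.card K : ℂ)⁻¹ • avgT K σ f := by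
    rw [avgT_of_mem_eqvRight hf, smul_smul, inv_mul_cancel₀ hK, one_smul]
  rw [this]
  exact T.smul_mem _ hT

/-! ## Twisted orbit transports -/

/-- **Twisting rule**: `A_σ t_{k₀ u, a} = σ(k₀) · A_σ t_{u, a}` (`k₀ ∈ K`). -/
theorem avgT_transport_smul (K : Subgroup (GLm p m)) (σ : K →* ℂˣ) (k₀ : K)
    (u a : Fin m → ZMod p) :
    avgT K σ (transport (k₀ • u) a) = (σ k₀ : ℂ) • avgT K σ (transport u a) := by
  funext g
  rw [avgT_apply, Pi.smul_apply, avgT_apply, smul_eq_mul, Finset.mul_sum]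
  refine Fintype.sum_equiv (Equiv.mulRight k₀) _ _ fun k => ?_
  have hs : (k₀ • u : Fin m → ZMod p) = ((k₀ : GLm p m) : Mat p m) *ᵥ u := rfl
  have hσ : (σ k⁻¹ : ℂ) = (σ k₀ : ℂ) * (σ (k * k₀)⁻¹ : ℂ) := by
    rw [← Units.val_mul, ← map_mul]
    congr 2
    group
  simp only [transport_apply, Equiv.coe_mulRight, hs, Matrix.mulVec_mulVec, Subgroup.coe_mul,
    Units.val_mul, hσ, mul_assoc]

/-- **Vanishing rule**: if some `k₀ ∈ K_u` has `σ(k₀) ≠ 1`, then `A_σ t_{u,a} = 0` (the orbit of `u`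
is not admissible and contributes nothing to `(F_1)_σ`). -/
theorem avgT_transport_eq_zero (K : Subgroup (GLm p m)) (σ : K →* ℂˣ) {u : Fin m → ZMod p}
    (k₀ : K) (hfix : k₀ • u = u) (hσ : σ k₀ ≠ 1) (a : Fin m → ZMod p) :
    avgT K σ (transport u a) = 0 := by
  have h := avgT_transport_smul K σ k₀ u a
  rw [hfix] at h
  have hc : (σ k₀ : ℂ) ≠ 1 := fun h1 => hσ (Units.val_eq_one.1 h1)
  have h2 : (1 - (σ k₀ : ℂ)) • avgT K σ (transport u a) = 0 := by
    rw [sub_smul, one_smul, ← h, sub_self]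
  exact (smul_eq_zero.1 h2).resolve_left (sub_ne_zero.2 (Ne.symm hc))

/-- `A_σ t_{u,a}` is a scalar multiple of `A_σ t_{out ω(u), a}`. -/
theorem avgT_transport_out (K : Subgroup (GLm p m)) (σ : K →* ℂˣ) (u a : Fin m → ZMod p) :
    ∃ c : ℂ, avgT K σ (transport u a) = c • avgT K σ (transport (orb K u).out a) := by
  obtain ⟨k, hk⟩ := exists_smul_eq_out K u
  refine ⟨((σ k)⁻¹ : ℂˣ), ?_⟩
  rw [← hk, avgT_transport_smul, smul_smul, Units.inv_mul, one_smul]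

/-- A non-admissible vector contributes nothing: `A_σ t_{u,a} = 0`. -/
theorem avgT_transport_eq_zero_of_not_mem_adm (K : Subgroup (GLm p m)) (σ : K →* ℂˣ)
    {u : Fin m → ZMod p} (hu : u ∉ adm K σ) (a : Fin m → ZMod p) :
    avgT K σ (transport u a) = 0 := by
  simp only [adm, Set.mem_setOf_eq, not_forall] at hu
  obtain ⟨k₀, hfix, hσ⟩ := hu
  exact avgT_transport_eq_zero K σ k₀ hfix hσ a

/-! ## The spanning set and the dimension bound -/

/-- The generating family: the twisted orbit transports `A_σ t_{out ω, rep ℓ}`, `ω` admissible. -/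
def gen (K : Subgroup (GLm p m)) (σ : K →* ℂˣ) :
    AdmOrb K σ × ℙ (ZMod p) (Fin m → ZMod p) → (GLm p m → ℂ) :=
  fun x => avgT K σ (transport x.1.1.out x.2.rep)

/-- Every twisted transport `A_σ t_{u,a}` lies in the span of the generating family (`σ ≠ 1`). -/
theorem avgT_transport_mem (K : Subgroup (GLm p m)) {σ : K →* ℂˣ} (hσ : σ ≠ 1)
    (u a : Fin m → ZMod p) :
    avgT K σ (transport u a) ∈ Submodule.span ℂ (Set.range (gen K σ)) := by
  set T := Submodule.span ℂ (Set.range (gen K σ)) with hT_def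
  by_cases hu : u ∈ adm K σ
  swap
  · rw [avgT_transport_eq_zero_of_not_mem_adm K σ hu]; exact T.zero_mem
  have hu0 : u ≠ 0 := fun h => zero_not_mem_adm hσ (h ▸ hu)
  by_cases ha : a = 0
  · subst ha
    rw [transport_zero_right]
    have : (fun _ : GLm p m => if u = 0 then (1 : ℂ) else 0) = 0 := by
      funext g; rw [if_neg hu0, Pi.zero_apply]
    rw [this, map_zero]; exact T.zero_mem
  · obtain ⟨μ, hμ⟩ := Projectivization.exists_smul_eq_mk_rep (ZMod p) a ha
    have ha' : a = μ⁻¹ • (Projectivization.mk (ZMod p) a ha).rep := by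
      rw [← hμ, inv_smul_smul]
    rw [ha', transport_smul, inv_inv]
    set ℓ := Projectivization.mk (ZMod p) a ha
    obtain ⟨c, hc⟩ := avgT_transport_out K σ (μ • u) ℓ.rep
    rw [hc]
    by_cases hadm : (orb K (μ • u)).out ∈ adm K σ
    · exact T.smul_mem c (Submodule.subset_span ⟨(⟨orb K (μ • u), hadm⟩, ℓ), rfl⟩)
    · rw [avgT_transport_eq_zero_of_not_mem_adm K σ hadm, smul_zero]; exact T.zero_mem

/-- `(F_1)_σ` lies in the span of the generating family (`σ ≠ 1`). -/
theorem eqvRight_levelOne_le_span (K : Subgroup (GLm p m)) {σ : K →* ℂˣ} (hσ : σ ≠ 1) :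
    eqvRight K σ (levelSubmodule p m 1) ≤ Submodule.span ℂ (Set.range (gen K σ)) := by
  intro f hf
  have hF : levelSubmodule p m 1 ≤ (Submodule.span ℂ (Set.range (gen K σ))).comap (avgT K σ) :=
    levelSubmodule_le_of_transport fun u a => by
      rw [Submodule.mem_comap]
      exact avgT_transport_mem K hσ u a
  have h := hF (eqvRight_le K σ _ hf)
  rw [Submodule.mem_comap] at h
  exact mem_of_avgT_mem hf h

/-- **THE EQUIVARIANT DIMENSION BOUND**: `dim (F_1)_σ ≤ ν_σ(K) · b` for every non-trivial linear
character `σ` of `K ≤ GL_m(𝔽_p)` (`ν_σ(K)` = number of `σ`-admissible `K`-orbits on vectors,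
`b = #ℙ^{m-1}(𝔽_p)`). -/
theorem finrank_eqvRight_levelOne_le (K : Subgroup (GLm p m)) {σ : K →* ℂˣ} (hσ : σ ≠ 1) :
    finrank ℂ (eqvRight K σ (levelSubmodule p m 1)) ≤
      Nat.card (AdmOrb K σ) * Nat.card (ℙ (ZMod p) (Fin m → ZMod p)) := by
  haveI : Fintype (ℙ (ZMod p) (Fin m → ZMod p)) := Fintype.ofFinite _
  have h1 := Submodule.finrank_mono (eqvRight_levelOne_le_span K hσ)
  have h2 : finrank ℂ (Submodule.span ℂ (Set.range (gen K σ))) ≤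
      Fintype.card (AdmOrb K σ × ℙ (ZMod p) (Fin m → ZMod p)) := finrank_range_le_card _
  rw [Fintype.card_prod] at h2
  rw [Nat.card_eq_fintype_card, Nat.card_eq_fintype_card]
  exact h1.trans h2

end LevelOneEquivariantDim
end Summit.MatrixMultiplication.MatrixMultiplication.Theorems.SubgroupIdentityDesigns.Negative

end
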